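import Mathlib
import HarnessLib
import Literature.MathematicalPhysics.StatisticalMechanics.TorusDiscreteLeibniz
import Literature.MathematicalPhysics.StatisticalMechanics.LatticeSobolevLine
import Literature.MathematicalPhysics.StatisticalMechanics.GradientFieldNorms

/-!
# Binomial polynomial test fields on the torus ([ABKM19] Ch. 8.4, "Polynomials on `ℤ^d`")

The duality between monomials in `∇` and polynomials on `ℤ^d` behind the projection `Π₂`
([ABKM19] (8.35)–(8.37), following [BS15II]): with the binomial polynomials
`binomR t n = t(t-1)⋯(t-n+1)/n!` (so `∇ binomR(·, n+1) = binomR(·, n)`, `binomR_pascal`) and, for a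
centre `c` of the torus `Λ = (ℤ/M)^d`, the relative integer coordinates
`z_i = valMinAbs (x_i - c_i)` (`relCoord`), the test fields
`b_α^c(x) = Π_i binomR(z_i, α_i)` (`polyField`) satisfy, on the region around `c` where the
coordinates do not wrap around the torus (`HasRoom c x n`: `(|z_i| + n)·2 < M` for all `i`),
* `iterDiff_polyField` — **`∇^β b_α = b_{α-β}`** for `β ≤ α` and `= 0` otherwise ((8.37));
* `polyField_self` — `b_α(c) = δ_{α0}`; `abs_polyField_le` — `|b_γ(x)| ≤ (ρ + |γ|)^{|γ|}` for
  `|z|_∞ ≤ ρ`;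
* `fieldGauge_polyField_apply`, `norm_fieldGauge_polyField_single_le` (`‖T b_{e_i}‖ ≤ R/𝔥`),
  `norm_fieldGauge_polyField_le` (`‖T b_α‖ ≤ C₀^{|α|} R^{|α|}/𝔥` when `ρ + |α| ≤ C₀R`): the field
  gauge `T = fieldGauge 𝔥 R p S` of the test fields (the rescaled basis `b̃_α` of the proof of
  Lemma 8.7).

Everything is proved; no named fact.

## References
* S. Adams, S. Buchholz, R. Kotecký, S. Müller, arXiv:1910.13564, Ch. 8.4 (8.35)–(8.37), proof of
  Lemma 8.7 [AdamsBuchholzKoteckyMuller2019].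
* D. Brydges, G. Slade, J. Stat. Phys. 159 (2015) 461–491, §3 [BrydgesSlade2015RGII].
-/

noncomputable section

namespace Literature.MathematicalPhysics.StatisticalMechanics.GradientRG

open Finset
open Literature.MathematicalPhysics.StatisticalMechanics.GradientFRD (iterDiff)

/-! ## Binomial polynomials -/

/-- `binomR t n = t(t-1)⋯(t-n+1)/n!`. [cite: AdamsBuchholzKoteckyMuller2019, Ch. 8.4 (8.35)] -/
def binomR (t : ℝ) (n : ℕ) : ℝ := (∏ j ∈ range n, (t - j)) / n.factorial

/-- `binomR t 0 = 1`. [cite: AdamsBuchholzKoteckyMuller2019, Ch. 8.4 (8.35)] -/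
@[simp] theorem binomR_zero (t : ℝ) : binomR t 0 = 1 := by simp [binomR]

/-- `binomR t 1 = t`. [cite: AdamsBuchholzKoteckyMuller2019, Ch. 8.4 (8.35)] -/
@[simp] theorem binomR_one (t : ℝ) : binomR t 1 = t := by simp [binomR]

/-- `binomR 0 n = 0` for `n ≥ 1`. [cite: AdamsBuchholzKoteckyMuller2019, Ch. 8.4 (8.35)] -/
theorem binomR_zero_left {n : ℕ} (hn : 1 ≤ n) : binomR 0 n = 0 := by
  unfold binomR
  rw [Finset.prod_eq_zero (i := 0) (Finset.mem_range.2 (by omega)) (by simp), zero_div]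

/-- **Pascal's rule** `binomR (t+1) (n+1) − binomR t (n+1) = binomR t n`, i.e. `∇ binomR(·,n+1) =
binomR(·,n)`. [cite: AdamsBuchholzKoteckyMuller2019, Ch. 8.4 (8.36)] -/
theorem binomR_pascal (t : ℝ) (n : ℕ) : binomR (t + 1) (n + 1) - binomR t (n + 1) = binomR t n := by
  unfold binomR
  rw [Finset.prod_range_succ' (fun j => t + 1 - (j : ℝ)), Finset.prod_range_succ (fun j => t - (j : ℝ))]
  have h1 : ∏ j ∈ range n, (t + 1 - ((j + 1 : ℕ) : ℝ)) = ∏ j ∈ range n, (t - j) :=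
    Finset.prod_congr rfl fun j _ => by push_cast; ring
  rw [h1, Nat.factorial_succ]
  have hf : (n.factorial : ℝ) ≠ 0 := by positivity
  push_cast
  field_simp
  ring

/-- `|binomR t n| ≤ (|t| + n)^n`. [cite: AdamsBuchholzKoteckyMuller2019, proof of Lemma 8.7] -/
theorem abs_binomR_le (t : ℝ) (n : ℕ) : |binomR t n| ≤ (|t| + n) ^ n := by
  unfold binomR
  rw [abs_div, Nat.abs_cast]
  have hf : (1 : ℝ) ≤ n.factorial := by exact_mod_cast Nat.succ_le_of_lt (Nat.factorial_pos n)
  calc |∏ j ∈ range n, (t - j)| / (n.factorial : ℝ) ≤ |∏ j ∈ range n, (t - j)| :=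
        div_le_self (abs_nonneg _) hf
    _ = ∏ j ∈ range n, |t - j| := Finset.abs_prod _ _
    _ ≤ ∏ _j ∈ range n, (|t| + n) := by
        refine Finset.prod_le_prod (fun j _ => abs_nonneg _) fun j hj => ?_
        have hj' : (j : ℝ) ≤ n := by exact_mod_cast (Finset.mem_range.1 hj).le
        calc |t - j| ≤ |t| + |(j : ℝ)| := abs_sub _ _
          _ = |t| + j := by rw [Nat.abs_cast]
          _ ≤ |t| + n := by linarith
    _ = (|t| + n) ^ n := by rw [Finset.prod_const, Finset.card_range]

variable {d M : ℕ} [NeZero M]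

/-! ## Relative coordinates around a centre -/

/-- The relative integer coordinate `z_i = valMinAbs (x_i − c_i) ∈ (−M/2, M/2]`.
[cite: AdamsBuchholzKoteckyMuller2019, Ch. 8.4 ("we can view `B^{++}` as a subset of `ℤ^d`")] -/
def relCoord (c x : Fin d → ZMod M) (i : Fin d) : ℤ := (x i - c i).valMinAbs

omit [NeZero M] in
/-- `z(c) = 0`. [cite: AdamsBuchholzKoteckyMuller2019, Ch. 8.4] -/
@[simp] theorem relCoord_self (c : Fin d → ZMod M) (i : Fin d) : relCoord c c i = 0 := by
  simp [relCoord]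

/-- **Non-wrapping**: `n` more unit steps from `x` stay inside the fundamental domain around `c`,
`(|z_i| + n)·2 < M` for all `i`. [cite: AdamsBuchholzKoteckyMuller2019, Ch. 8.4] -/
def HasRoom (c x : Fin d → ZMod M) (n : ℕ) : Prop := ∀ i, (|relCoord c x i| + n) * 2 < (M : ℤ)

omit [NeZero M] in
/-- Monotonicity of the room in `n`. [cite: AdamsBuchholzKoteckyMuller2019, Ch. 8.4] -/
theorem HasRoom.mono {c x : Fin d → ZMod M} {m n : ℕ} (h : HasRoom c x n) (hmn : m ≤ n) :
    HasRoom c x m := fun i => by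
  have := h i
  have : (m : ℤ) ≤ n := by exact_mod_cast hmn
  linarith

omit [NeZero M] in
/-- Room from a box bound `|z|_∞ ≤ ρ` with `(ρ + n)·2 < M`. [cite: AdamsBuchholzKoteckyMuller2019, Ch. 8.4] -/
theorem hasRoom_of_le {c x : Fin d → ZMod M} {ρ n : ℕ} (hx : ∀ i, |relCoord c x i| ≤ ρ)
    (hρ : (ρ + n) * 2 < M) : HasRoom c x n := fun i => by
  have h1 := hx i
  have h2 : ((ρ : ℤ) + n) * 2 < M := by exact_mod_cast hρ
  linarith

/-- A unit step in direction `i` raises `z_i` by one (given room). [cite: AdamsBuchholzKoteckyMuller2019, Ch. 8.4] -/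
theorem relCoord_add_single_self {c x : Fin d → ZMod M} {i : Fin d}
    (h : (relCoord c x i + 1) * 2 ≤ (M : ℤ)) :
    relCoord c (x + Pi.single i 1) i = relCoord c x i + 1 := by
  unfold relCoord at *
  rw [ZMod.valMinAbs_spec]
  refine ⟨?_, ?_, h⟩
  · rw [Pi.add_apply, Pi.single_eq_same, Int.cast_add, Int.cast_one, ZMod.coe_valMinAbs]; ring
  · have := (ZMod.valMinAbs_mem_Ioc (x i - c i)).1
    linarith

omit [NeZero M] in
/-- A unit step in direction `i` leaves `z_j`, `j ≠ i`, unchanged. [cite: AdamsBuchholzKoteckyMuller2019, Ch. 8.4] -/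
theorem relCoord_add_single_ne {c x : Fin d → ZMod M} {i j : Fin d} (hij : j ≠ i) :
    relCoord c (x + Pi.single i 1) j = relCoord c x j := by
  simp [relCoord, Pi.add_apply, Pi.single_eq_of_ne hij]

/-- Room propagates along a unit step. [cite: AdamsBuchholzKoteckyMuller2019, Ch. 8.4] -/
theorem HasRoom.step {c x : Fin d → ZMod M} {n : ℕ} (h : HasRoom c x (n + 1)) (i : Fin d) :
    HasRoom c (x + Pi.single i 1) n := by
  intro j
  by_cases hji : j = i
  · subst hji
    have hj := h j
    have hroom : (relCoord c x j + 1) * 2 ≤ (M : ℤ) := by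
      have := le_abs_self (relCoord c x j); push_cast at hj; linarith
    rw [relCoord_add_single_self hroom]
    have : |relCoord c x j + 1| ≤ |relCoord c x j| + 1 := (abs_add_le _ _).trans (by rw [abs_one])
    push_cast at hj
    linarith
  · rw [relCoord_add_single_ne hji]
    have := h j
    push_cast at this ⊢
    linarith

omit [NeZero M] in
/-- Room for one step gives the non-wrapping condition of `relCoord_add_single_self`.
[cite: AdamsBuchholzKoteckyMuller2019, Ch. 8.4] -/
theorem HasRoom.succ_le {c x : Fin d → ZMod M} {n : ℕ} (h : HasRoom c x (n + 1)) (i : Fin d) :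
    (relCoord c x i + 1) * 2 ≤ (M : ℤ) := by
  have hi := h i
  have := le_abs_self (relCoord c x i)
  push_cast at hi
  linarith

/-! ## The polynomial test fields `b_α^c` -/

/-- **`b_α^c(x) = Π_i binomR(z_i, α_i)`**, the binomial polynomial test field of multi-degree `α`
centred at `c`. [cite: AdamsBuchholzKoteckyMuller2019, Ch. 8.4 (8.35)] -/
def polyField (c : Fin d → ZMod M) (α : Fin d → ℕ) (x : Fin d → ZMod M) : ℝ :=
  ∏ i, binomR (relCoord c x i) (α i)

omit [NeZero M] in
/-- `b_0 = 1`. [cite: AdamsBuchholzKoteckyMuller2019, Ch. 8.4 (8.35)] -/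
@[simp] theorem polyField_zero_index (c x : Fin d → ZMod M) : polyField c 0 x = 1 := by
  simp [polyField]

omit [NeZero M] in
/-- `b_α(c) = δ_{α,0}`. [cite: AdamsBuchholzKoteckyMuller2019, Ch. 8.4 (8.35)] -/
theorem polyField_self (c : Fin d → ZMod M) (α : Fin d → ℕ) :
    polyField c α c = if α = 0 then 1 else 0 := by
  split_ifs with hα
  · rw [hα, polyField_zero_index]
  · obtain ⟨i, hi⟩ : ∃ i, α i ≠ 0 := by
      by_contra hcon; push Not at hcon; exact hα (funext hcon)
    unfold polyField
    refine Finset.prod_eq_zero (Finset.mem_univ i) ?_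
    rw [relCoord_self, Int.cast_zero]
    exact binomR_zero_left (Nat.one_le_iff_ne_zero.2 hi)

/-- **`∇_i b_α = b_{α − e_i}`** (and `= 0` if `α_i = 0`), at points with room for one step.
[cite: AdamsBuchholzKoteckyMuller2019, Ch. 8.4 (8.36)] -/
theorem fwdDiff_polyField {c x : Fin d → ZMod M} (hx : HasRoom c x 1) (α : Fin d → ℕ) (i : Fin d) :
    GradientFRD.fwdDiff i (polyField c α) x =
      if 1 ≤ α i then polyField c (α - Pi.single i 1) x else 0 := by
  unfold GradientFRD.fwdDiff polyField
  rw [← Finset.mul_prod_erase _ _ (Finset.mem_univ i), ← Finset.mul_prod_erase _ _ (Finset.mem_univ i)]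
  have hP : ∏ j ∈ univ.erase i, binomR (relCoord c (x + Pi.single i 1) j) (α j) =
      ∏ j ∈ univ.erase i, binomR (relCoord c x j) (α j) :=
    Finset.prod_congr rfl fun j hj => by rw [relCoord_add_single_ne (Finset.ne_of_mem_erase hj)]
  rw [hP, relCoord_add_single_self (hx.succ_le i), ← sub_mul]
  split_ifs with h1
  · obtain ⟨m, hm⟩ : ∃ m, α i = m + 1 := ⟨α i - 1, by omega⟩
    rw [← Finset.mul_prod_erase _ _ (Finset.mem_univ i)]
    have hP' : ∏ j ∈ univ.erase i, binomR (relCoord c x j) ((α - Pi.single i 1 : Fin d → ℕ) j) =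
        ∏ j ∈ univ.erase i, binomR (relCoord c x j) (α j) :=
      Finset.prod_congr rfl fun j hj => by
        rw [Pi.sub_apply, Pi.single_eq_of_ne (Finset.ne_of_mem_erase hj), Nat.sub_zero]
    rw [hP', Pi.sub_apply, Pi.single_eq_same, hm, Nat.add_sub_cancel, Int.cast_add, Int.cast_one,
      binomR_pascal]
  · have h0 : α i = 0 := by omega
    rw [h0, binomR_zero, binomR_zero, sub_self, zero_mul]

/-- `∇_i b_{e_j} = δ_{ij}` (room for one step). [cite: AdamsBuchholzKoteckyMuller2019, Ch. 8.4 (8.36)] -/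
theorem fwdDiff_polyField_single {c x : Fin d → ZMod M} (hx : HasRoom c x 1) (i j : Fin d) :
    GradientFRD.fwdDiff i (polyField c (Pi.single j 1)) x = if i = j then 1 else 0 := by
  rw [fwdDiff_polyField hx]
  by_cases h : i = j
  · subst h
    simp
  · rw [if_neg h, if_neg]
    simp [Pi.single_eq_of_ne h]

/-- **`∇^β b_α = b_{α−β}` for `β ≤ α`, `∇^β b_α = 0` otherwise** ((8.37)), at points with room for
`|β|` steps. [cite: AdamsBuchholzKoteckyMuller2019, Ch. 8.4 (8.37)] -/
theorem iterDiff_polyField {c : Fin d → ZMod M} (α : Fin d → ℕ) :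
    ∀ (n : ℕ) (β : Fin d → ℕ), ∑ i, β i = n → ∀ x : Fin d → ZMod M, HasRoom c x n →
      iterDiff β (polyField c α) x = if (∀ i, β i ≤ α i) then polyField c (α - β) x else 0 := by
  intro n
  induction n with
  | zero =>
    intro β hβ x _
    have hβ0 : β = 0 := funext fun i => by
      have : β i ≤ ∑ j, β j := Finset.single_le_sum (fun j _ => Nat.zero_le (β j)) (Finset.mem_univ i)
      simpa [hβ] using this
    subst hβ0
    simp
  | succ n ih =>
    intro β hβ x hx
    obtain ⟨i, β', rfl, hβ'⟩ := exists_eq_add_single hβ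
    rw [iterDiff_add_single]
    unfold GradientFRD.fwdDiff
    rw [ih β' hβ' (x + Pi.single i 1) (hx.step i), ih β' hβ' x (hx.mono (Nat.le_succ n))]
    by_cases hle : ∀ j, β' j ≤ α j
    · rw [if_pos hle, if_pos hle]
      have hfd := fwdDiff_polyField (hx.mono (by omega) : HasRoom c x 1) (α - β') i
      unfold GradientFRD.fwdDiff at hfd
      rw [hfd, Pi.sub_apply]
      have hsub : α - β' - (Pi.single i 1 : Fin d → ℕ) = α - (β' + Pi.single i 1) :=
        funext fun j => by simp only [Pi.sub_apply, Pi.add_apply]; omega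
      rw [hsub]
      by_cases hi : β' i + 1 ≤ α i
      · rw [if_pos (by omega), if_pos]
        intro j
        by_cases hj : j = i
        · subst hj; simpa using hi
        · simpa [Pi.add_apply, Pi.single_eq_of_ne hj] using hle j
      · rw [if_neg (by omega), if_neg]
        intro hcon
        have := hcon i
        simp only [Pi.add_apply, Pi.single_eq_same] at this
        exact hi this
    · rw [if_neg hle, if_neg hle, sub_self, if_neg]
      intro hcon
      exact hle fun j => le_trans (by simp) (hcon j)

/-- Pointwise form of `iterDiff_polyField`. [cite: AdamsBuchholzKoteckyMuller2019, Ch. 8.4 (8.37)] -/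
theorem iterDiff_polyField' {c x : Fin d → ZMod M} {n : ℕ} (hx : HasRoom c x n) (α β : Fin d → ℕ)
    (hβ : ∑ i, β i ≤ n) :
    iterDiff β (polyField c α) x = if (∀ i, β i ≤ α i) then polyField c (α - β) x else 0 :=
  iterDiff_polyField α _ β rfl x (hx.mono hβ)

/-! ## Size of the test fields -/

omit [NeZero M] in
/-- `|b_γ(x)| ≤ (ρ + |γ|)^{|γ|}` on the box `|z|_∞ ≤ ρ`.
[cite: AdamsBuchholzKoteckyMuller2019, proof of Lemma 8.7] -/
theorem abs_polyField_le {c x : Fin d → ZMod M} {ρ : ℕ} (hx : ∀ i, |relCoord c x i| ≤ ρ)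
    (γ : Fin d → ℕ) : |polyField c γ x| ≤ ((ρ : ℝ) + ∑ i, γ i) ^ (∑ i, γ i) := by
  unfold polyField
  rw [Finset.abs_prod]
  have hγi : ∀ i, γ i ≤ ∑ j, γ j := fun i =>
    Finset.single_le_sum (fun j _ => Nat.zero_le (γ j)) (Finset.mem_univ i)
  have hρ : (0 : ℝ) ≤ ρ := Nat.cast_nonneg _
  calc ∏ i, |binomR (relCoord c x i) (γ i)|
      ≤ ∏ i, ((ρ : ℝ) + ∑ j, γ j) ^ (γ i) := by
        refine Finset.prod_le_prod (fun i _ => abs_nonneg _) fun i _ => ?_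
        refine (abs_binomR_le _ _).trans (pow_le_pow_left₀ (by positivity) ?_ _)
        have h1 : |((relCoord c x i : ℤ) : ℝ)| ≤ ρ := by
          rw [← Int.cast_abs]; exact_mod_cast hx i
        have h2 : ((γ i : ℕ) : ℝ) ≤ ((∑ j, γ j : ℕ) : ℝ) := by exact_mod_cast hγi i
        push_cast at h2 ⊢
        linarith
    _ = ((ρ : ℝ) + ∑ j, γ j) ^ (∑ i, γ i) := Finset.prod_pow_eq_pow_sum _ _ _

omit [NeZero M] in
/-- `Σ_{x∈B} b_0(x) = |B|`. [cite: AdamsBuchholzKoteckyMuller2019, Ch. 8.4 (8.49)] -/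
theorem sum_polyField_zero_index (c : Fin d → ZMod M) (B : Finset (Fin d → ZMod M)) :
    ∑ x ∈ B, polyField c 0 x = B.card := by simp

omit [NeZero M] in
/-- `|Σ_{x∈B} b_γ(x)| ≤ |B| (ρ + |γ|)^{|γ|}` if `B` lies in the box `|z|_∞ ≤ ρ`.
[cite: AdamsBuchholzKoteckyMuller2019, proof of Lemma 8.7] -/
theorem abs_sum_polyField_le {c : Fin d → ZMod M} {B : Finset (Fin d → ZMod M)} {ρ : ℕ}
    (hB : ∀ x ∈ B, ∀ i, |relCoord c x i| ≤ ρ) (γ : Fin d → ℕ) :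
    |∑ x ∈ B, polyField c γ x| ≤ B.card * ((ρ : ℝ) + ∑ i, γ i) ^ (∑ i, γ i) := by
  calc |∑ x ∈ B, polyField c γ x| ≤ ∑ x ∈ B, |polyField c γ x| := Finset.abs_sum_le_sum_abs _ _
    _ ≤ ∑ _x ∈ B, ((ρ : ℝ) + ∑ i, γ i) ^ (∑ i, γ i) :=
        Finset.sum_le_sum fun x hx => abs_polyField_le (hB x hx) γ
    _ = B.card * ((ρ : ℝ) + ∑ i, γ i) ^ (∑ i, γ i) := by rw [Finset.sum_const, nsmul_eq_mul]

/-! ## The field gauge of the test fields -/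

/-- Components of `T b_α`, `T = fieldGauge 𝔥 R p S`: `𝔥⁻¹R^{|β|} b_{α−β}(x)` for `β ≤ α`, else `0`
(room for `p` steps on `S`). [cite: AdamsBuchholzKoteckyMuller2019, proof of Lemma 8.7] -/
theorem fieldGauge_polyField_apply {c : Fin d → ZMod M} {S : Finset (Fin d → ZMod M)} {p : ℕ}
    (hS : ∀ x ∈ S, HasRoom c x p) (𝔥 R : ℝ) (α : Fin d → ℕ) (q : S × diffIndex d p) :
    fieldGauge 𝔥 R p S (polyField c α) q = 𝔥⁻¹ * R ^ (∑ i, (q.2 : Fin d → ℕ) i) *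
      (if (∀ i, (q.2 : Fin d → ℕ) i ≤ α i) then polyField c (α - q.2) q.1 else 0) := by
  rw [fieldGauge_apply, iterDiff_polyField' (hS q.1 q.1.2) α q.2 (mem_diffIndex.1 q.2.2).2]

/-- **`‖T b_{e_i}‖ ≤ R/𝔥`** (`𝔥 > 0`, `R ≥ 0`). [cite: AdamsBuchholzKoteckyMuller2019, proof of Lemma 8.7] -/
theorem norm_fieldGauge_polyField_single_le {c : Fin d → ZMod M} {S : Finset (Fin d → ZMod M)}
    {p : ℕ} (hS : ∀ x ∈ S, HasRoom c x p) {𝔥 R : ℝ} (h𝔥 : 0 < 𝔥) (hR : 0 ≤ R) (i : Fin d) :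
    ‖fieldGauge 𝔥 R p S (polyField c (Pi.single i 1))‖ ≤ R / 𝔥 := by
  refine (pi_norm_le_iff_of_nonneg (by positivity)).2 fun q => ?_
  rw [fieldGauge_polyField_apply hS, Real.norm_eq_abs]
  split_ifs with hle
  · -- `β ≤ e_i` with `|β| ≥ 1` forces `β = e_i`
    have hβ1 := (mem_diffIndex.1 q.2.2).1
    have hβ : (q.2 : Fin d → ℕ) = Pi.single i 1 := by
      funext j
      by_cases hj : j = i
      · subst hj
        have h1 := hle j
        simp only [Pi.single_eq_same] at h1
        have h2 : ∀ l, l ≠ j → (q.2 : Fin d → ℕ) l = 0 := fun l hl => by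
          have := hle l; simpa [Pi.single_eq_of_ne hl] using this
        have h3 : ∑ l, (q.2 : Fin d → ℕ) l = (q.2 : Fin d → ℕ) j := by
          rw [Finset.sum_eq_single j (fun l _ hl => h2 l hl) (by simp)]
        simp only [Pi.single_eq_same]
        omega
      · have := hle j; simpa [Pi.single_eq_of_ne hj] using this
    rw [hβ, tsub_self, polyField_zero_index, mul_one]
    have hs : ∑ l, (Pi.single i 1 : Fin d → ℕ) l = 1 := by simp
    rw [hs, pow_one, abs_of_nonneg (by positivity), div_eq_inv_mul]
  · rw [mul_zero, abs_zero]; positivity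

/-- **`‖T b_α‖ ≤ C₀^{|α|} R^{|α|}/𝔥`** on a gauge set `S` in the box `|z|_∞ ≤ ρ` with
`ρ + |α| ≤ C₀R`, `C₀ ≥ 1` (the rescaled basis `b̃_α = 𝔥R^{-|α|}b_α` is bounded).
[cite: AdamsBuchholzKoteckyMuller2019, proof of Lemma 8.7 (8.51)] -/
theorem norm_fieldGauge_polyField_le {c : Fin d → ZMod M} {S : Finset (Fin d → ZMod M)} {p ρ : ℕ}
    (hS : ∀ x ∈ S, HasRoom c x p) (hSρ : ∀ x ∈ S, ∀ i, |relCoord c x i| ≤ ρ) {𝔥 R C₀ : ℝ}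
    (h𝔥 : 0 < 𝔥) (hR : 0 < R) (hC₀ : 1 ≤ C₀) (α : Fin d → ℕ) (hρ : (ρ : ℝ) + ∑ i, α i ≤ C₀ * R) :
    ‖fieldGauge 𝔥 R p S (polyField c α)‖ ≤ C₀ ^ (∑ i, α i) * R ^ (∑ i, α i) / 𝔥 := by
  refine (pi_norm_le_iff_of_nonneg (by positivity)).2 fun q => ?_
  rw [fieldGauge_polyField_apply hS, Real.norm_eq_abs]
  split_ifs with hle
  · set β : Fin d → ℕ := (q.2 : diffIndex d p).1 with hβ
    set a := ∑ i, α i with ha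
    set b := ∑ i, β i with hb
    have hba : b ≤ a := Finset.sum_le_sum fun i _ => hle i
    have hγ : ∑ i, (α - β) i = a - b := by
      have : ∑ i, (α - β) i + b = a := by
        rw [hb, ← Finset.sum_add_distrib]; exact Finset.sum_congr rfl fun i _ => Nat.sub_add_cancel (hle i)
      omega
    have hpoly : |polyField c (α - β) q.1| ≤ (C₀ * R) ^ (a - b) := by
      refine (abs_polyField_le (hSρ q.1 q.1.2) _).trans ?_
      rw [hγ]
      refine pow_le_pow_left₀ (by positivity) ?_ _
      have : ((a - b : ℕ) : ℝ) ≤ a := by exact_mod_cast Nat.sub_le a b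
      linarith
    rw [abs_mul, abs_mul, abs_inv, abs_of_pos h𝔥, abs_of_nonneg (by positivity)]
    calc 𝔥⁻¹ * R ^ b * |polyField c (α - β) q.1| ≤ 𝔥⁻¹ * R ^ b * (C₀ * R) ^ (a - b) := by gcongr
      _ = C₀ ^ (a - b) * R ^ a / 𝔥 := by
          rw [mul_pow, div_eq_inv_mul]
          have : R ^ a = R ^ b * R ^ (a - b) := by rw [← pow_add, Nat.add_sub_cancel' hba]
          rw [this]; ring
      _ ≤ C₀ ^ a * R ^ a / 𝔥 := by
          gcongr
          exact Nat.sub_le a b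
  · rw [mul_zero, abs_zero]; positivity

end Literature.MathematicalPhysics.StatisticalMechanics.GradientRG

end
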